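import Mathlib

/-!
# A verified branch-and-bound for antitone dyadic objectives under hitting constraints

Solo-blind programme, kernel plan K3.35 step 2 (the reflected checker of the per-family TYPE ORACLE,
K3.33).  This file is purely combinatorial and knows nothing about groups: an INSTANCE consists of
`nW` slots `k < nW` (the coordinate types), a usability predicate `ok`, a list of `members` `M` with
sizes `csz M`, an incidence `r1 k M` ("slot `k` is a block type with residue `1` at member `M`") and a
hitting relation `hit k c` against `ncons` constraints.  The OBJECTIVE of a finite set of slots `U` is
`val U = ∑_{M ∈ members} 2^{S - csz M - #{k ∈ U : r1 k M}}` (scaled by `2^S`, terms below `1` rounded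
UP to `1`), which is antitone in `U`.  `soloBlindCheck I S bound = true` certifies that EVERY set
`V` of usable slots hitting all constraints has `val V ≤ bound` (`soloBlindCheck_sound`).

The search (`soloBlindBB`) prunes by the antitone objective, by LOOKAHEAD (some still-available hitter
of each unsatisfied constraint must eventually be added) and branches on an unsatisfied constraint over
its available hitters with SIBLING EXCLUSION (the first hitter lying in `V` is branched on with all
earlier siblings excluded).  Out of fuel it answers `false`, so soundness needs no termination argument.
Nothing here bears on `ω`.
-/

namespace Summit.MatrixMultiplication.MatrixMultiplication.Theorems

/-- A branch-and-bound instance: slots `k < nW` with usability `ok`, members with sizes `csz`,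
residue-one incidence `r1 k M`, and `ncons` hitting constraints `hit k c`. -/
structure SoloBlindBBInst where
  /-- number of slots -/
  nW : ℕ
  /-- number of constraints -/
  ncons : ℕ
  /-- the members of the family -/
  members : List ℕ
  /-- size of a member -/
  csz : ℕ → ℕ
  /-- usable slots -/
  ok : ℕ → Bool
  /-- `r1 k M`: slot `k` counts at member `M` -/
  r1 : ℕ → ℕ → Bool
  /-- `hit k c`: slot `k` hits constraint `c` -/
  hit : ℕ → ℕ → Bool

/-- `2^{S-e}`, rounded up to `1` when `e > S`. -/
def soloBlindPow2T (S e : ℕ) : ℕ := if e ≤ S then 2 ^ (S - e) else 1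

/-- Number of chosen slots counting at member `M`. -/
def soloBlindCnt (I : SoloBlindBBInst) (U : Finset ℕ) (M : ℕ) : ℕ :=
  (U.filter fun k => I.r1 k M = true).card

/-- The scaled objective `∑_{M} 2^{S - csz M - cnt U M}`. -/
def soloBlindVal (I : SoloBlindBBInst) (S : ℕ) (U : Finset ℕ) : ℕ :=
  (I.members.map fun M => soloBlindPow2T S (I.csz M + soloBlindCnt I U M)).sum

/-- Constraint `c` is hit by some chosen slot. -/
def soloBlindSat (I : SoloBlindBBInst) (U : Finset ℕ) (c : ℕ) : Bool :=
  decide (∃ k ∈ U, I.hit k c = true)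

/-- The unsatisfied constraints. -/
def soloBlindUnsat (I : SoloBlindBBInst) (U : Finset ℕ) : List ℕ :=
  (List.range I.ncons).filter fun c => !soloBlindSat I U c

/-- Available hitters of constraint `c`: usable slots hitting `c`, neither chosen nor excluded. -/
def soloBlindAvail (I : SoloBlindBBInst) (c : ℕ) (U E : Finset ℕ) : List ℕ :=
  (List.range I.nW).filter fun k => I.ok k && I.hit k c && !decide (k ∈ U) && !decide (k ∈ E)

/-- Branch over a list of hitters with sibling exclusion. -/
def soloBlindBranch (f : Finset ℕ → Finset ℕ → Bool) (U : Finset ℕ) : List ℕ → Finset ℕ → Bool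
  | [], _ => true
  | k :: rest, E => f (insert k U) E && soloBlindBranch f U rest (insert k E)

/-- The branching constraint: an unsatisfied constraint with fewest available hitters. -/
def soloBlindPick (I : SoloBlindBBInst) (U E : Finset ℕ) (uns : List ℕ) : ℕ :=
  match uns.argmin (fun c => (soloBlindAvail I c U E).length) with
  | some c => c
  | none => 0

/-- The fuelled branch-and-bound. -/
def soloBlindBB (I : SoloBlindBBInst) (S bound : ℕ) : ℕ → Finset ℕ → Finset ℕ → Bool
  | 0, _, _ => false
  | fuel + 1, U, E =>
    if soloBlindVal I S U ≤ bound then true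
    else if (soloBlindUnsat I U).isEmpty then false
    else if (soloBlindUnsat I U).any (fun c => (soloBlindAvail I c U E).all fun k =>
        decide (soloBlindVal I S (insert k U) ≤ bound)) then true
    else soloBlindBranch (soloBlindBB I S bound fuel) U
        (soloBlindAvail I (soloBlindPick I U E (soloBlindUnsat I U)) U E) E

/-- The check from the empty selection. -/
def soloBlindCheck (I : SoloBlindBBInst) (S bound : ℕ) : Bool :=
  soloBlindBB I S bound (I.nW + 1) ∅ ∅

/-! ## Soundness -/

/-- `soloBlindPow2T S` is antitone in the exponent. -/
theorem soloBlindPow2T_antitone (S : ℕ) {e e' : ℕ} (h : e ≤ e') :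
    soloBlindPow2T S e' ≤ soloBlindPow2T S e := by
  unfold soloBlindPow2T
  split_ifs with h1 h2 h2
  · exact Nat.pow_le_pow_right (by norm_num) (by omega)
  · omega
  · exact Nat.one_le_two_pow
  · exact le_rfl

/-- Counts are monotone in the chosen set. -/
theorem soloBlindCnt_mono (I : SoloBlindBBInst) {U V : Finset ℕ} (h : U ⊆ V) (M : ℕ) :
    soloBlindCnt I U M ≤ soloBlindCnt I V M :=
  Finset.card_le_card (Finset.filter_subset_filter _ h)

/-- The objective is antitone in the chosen set. -/
theorem soloBlindVal_antitone (I : SoloBlindBBInst) (S : ℕ) {U V : Finset ℕ} (h : U ⊆ V) :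
    soloBlindVal I S V ≤ soloBlindVal I S U := by
  unfold soloBlindVal
  exact List.sum_le_sum fun M _ =>
    soloBlindPow2T_antitone S (Nat.add_le_add_left (soloBlindCnt_mono I h M) _)

/-- Members of the unsatisfied list are constraints hit by no chosen slot. -/
theorem soloBlind_mem_unsat {I : SoloBlindBBInst} {U : Finset ℕ} {c : ℕ} (hc : c ∈ soloBlindUnsat I U) :
    c < I.ncons ∧ ∀ k ∈ U, I.hit k c = false := by
  unfold soloBlindUnsat soloBlindSat at hc
  rw [List.mem_filter, List.mem_range] at hc
  refine ⟨hc.1, fun k hk => ?_⟩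
  have h2 := hc.2
  simp only [Bool.not_eq_true', decide_eq_false_iff_not, not_exists, not_and] at h2
  simpa using h2 k hk

/-- Membership in the list of available hitters. -/
theorem soloBlind_mem_avail {I : SoloBlindBBInst} {c k : ℕ} {U E : Finset ℕ} :
    k ∈ soloBlindAvail I c U E ↔ k < I.nW ∧ I.ok k = true ∧ I.hit k c = true ∧ k ∉ U ∧ k ∉ E := by
  unfold soloBlindAvail
  rw [List.mem_filter, List.mem_range]
  simp only [Bool.and_eq_true, Bool.not_eq_true', decide_eq_false_iff_not]
  tauto

/-- The branching constraint is one of the unsatisfied constraints. -/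
theorem soloBlindPick_mem (I : SoloBlindBBInst) (U E : Finset ℕ) {uns : List ℕ} (h : uns ≠ []) :
    soloBlindPick I U E uns ∈ uns := by
  unfold soloBlindPick
  split
  · rename_i c hc
    exact List.argmin_mem hc
  · rename_i hnone
    exact absurd (List.argmin_eq_none.mp hnone) h

/-- A hitter of an unsatisfied constraint lying in a valid completion is available. -/
theorem soloBlind_hitter_avail {I : SoloBlindBBInst} {U E V : Finset ℕ} {c : ℕ}
    (hc : c ∈ soloBlindUnsat I U) (hok : ∀ k ∈ V, k < I.nW ∧ I.ok k = true)
    (hVE : ∀ k ∈ V, k ∉ U → k ∉ E) (hhit : ∀ c < I.ncons, ∃ k ∈ V, I.hit k c = true) :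
    ∃ k ∈ soloBlindAvail I c U E, k ∈ V := by
  obtain ⟨hcn, hno⟩ := soloBlind_mem_unsat hc
  obtain ⟨k, hkV, hk⟩ := hhit c hcn
  have hkU : k ∉ U := fun hkU => by simp [hno k hkU] at hk
  exact ⟨k, soloBlind_mem_avail.mpr ⟨(hok k hkV).1, (hok k hkV).2, hk, hkU, hVE k hkV hkU⟩, hkV⟩

/-- Soundness of branching with sibling exclusion. -/
theorem soloBlindBranch_sound {I : SoloBlindBBInst} {S bound : ℕ} {f : Finset ℕ → Finset ℕ → Bool}
    {U V : Finset ℕ} (hUV : U ⊆ V)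
    (hf : ∀ U' E' : Finset ℕ, f U' E' = true → U' ⊆ V → (∀ k ∈ V, k ∉ U' → k ∉ E') →
      soloBlindVal I S V ≤ bound) :
    ∀ (lst : List ℕ) (E : Finset ℕ), soloBlindBranch f U lst E = true →
      (∀ k ∈ V, k ∉ U → k ∉ E) → (∃ k ∈ lst, k ∈ V) → soloBlindVal I S V ≤ bound := by
  intro lst
  induction lst with
  | nil => intro E _ _ hex; simp at hex
  | cons k rest ih =>
    intro E hb hVE hex
    simp only [soloBlindBranch, Bool.and_eq_true] at hb
    by_cases hkV : k ∈ V
    · exact hf (insert k U) E hb.1 (Finset.insert_subset hkV hUV)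
        (fun k' hk' hk'U => hVE k' hk' (fun hh => hk'U (Finset.mem_insert_of_mem hh)))
    · obtain ⟨k₀, hk₀, hk₀V⟩ := hex
      have hk₀rest : k₀ ∈ rest := by
        rcases List.mem_cons.mp hk₀ with rfl | hr
        · exact absurd hk₀V hkV
        · exact hr
      refine ih (insert k E) hb.2 (fun k' hk' hk'U => ?_) ⟨k₀, hk₀rest, hk₀V⟩
      rw [Finset.mem_insert, not_or]
      exact ⟨fun hh => hkV (hh ▸ hk'), hVE k' hk' hk'U⟩

/-- SOUNDNESS OF THE BRANCH-AND-BOUND: if it answers `true` from `(U, E)`, every valid completion `V`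
(`U ⊆ V`, slots usable, new slots outside `E`, all constraints hit) has objective `≤ bound`. -/
theorem soloBlindBB_sound (I : SoloBlindBBInst) (S bound : ℕ) :
    ∀ (fuel : ℕ) (U E V : Finset ℕ), soloBlindBB I S bound fuel U E = true → U ⊆ V →
      (∀ k ∈ V, k < I.nW ∧ I.ok k = true) → (∀ k ∈ V, k ∉ U → k ∉ E) →
      (∀ c < I.ncons, ∃ k ∈ V, I.hit k c = true) → soloBlindVal I S V ≤ bound := by
  intro fuel
  induction fuel with
  | zero => intro U E V hb; simp [soloBlindBB] at hb
  | succ fuel ih =>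
    intro U E V hb hUV hok hVE hhit
    unfold soloBlindBB at hb
    split_ifs at hb with h1 h2 h3
    · exact (soloBlindVal_antitone I S hUV).trans h1
    · obtain ⟨c, hc, hall⟩ := List.any_eq_true.mp h3
      rw [List.all_eq_true] at hall
      obtain ⟨k, hk, hkV⟩ := soloBlind_hitter_avail hc hok hVE hhit
      have hle : soloBlindVal I S (insert k U) ≤ bound := by simpa using hall k hk
      exact (soloBlindVal_antitone I S (Finset.insert_subset hkV hUV)).trans hle
    · have hne : soloBlindUnsat I U ≠ [] := by
        intro he; rw [he] at h2; exact h2 rfl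
      exact soloBlindBranch_sound hUV (fun U' E' hb' hU'V hVE' => ih U' E' V hb' hU'V hok hVE' hhit) _ E hb
        hVE (soloBlind_hitter_avail (soloBlindPick_mem I U E hne) hok hVE hhit)

/-- SOUNDNESS OF THE CHECK: every set of usable slots hitting all constraints has objective `≤ bound`. -/
theorem soloBlindCheck_sound (I : SoloBlindBBInst) (S bound : ℕ) (h : soloBlindCheck I S bound = true)
    (V : Finset ℕ) (hok : ∀ k ∈ V, k < I.nW ∧ I.ok k = true)
    (hhit : ∀ c < I.ncons, ∃ k ∈ V, I.hit k c = true) : soloBlindVal I S V ≤ bound :=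
  soloBlindBB_sound I S bound _ ∅ ∅ V h (Finset.empty_subset V) hok (fun _ _ _ => Finset.notMem_empty _)
    hhit

end Summit.MatrixMultiplication.MatrixMultiplication.Theorems
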